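import Literature.RingTheory.HilbertSamuel.NormalFlatness
import Literature.RingTheory.HilbertSamuel.GradedPieceLocalization
import Mathlib.RingTheory.Flat.Stability
import Mathlib.RingTheory.Localization.BaseChange
import Mathlib.RingTheory.Localization.Ideal
import Mathlib.RingTheory.Ideal.Over
import Mathlib.RingTheory.Ideal.MinimalPrime.Basic
import Mathlib.RingTheory.RegularLocalRing.Defs
import HarnessLib

/-!
# Normal flatness and permissibility are stable under localization and under ring isomorphisms
# (Cossart–Jannsen–Saito 2020, Def. 3.1 — transport lemmas)

Topic: `Literature/RingTheory/HilbertSamuel`. CJS, LNM 2270, Def. 3.1 defines normal flatness of `X` along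
`D = V(I)` at `x` by flatness of `gr_{I_x}(𝒪_{X,x}) = ⊕_t I_x^t/I_x^{t+1}` over `𝒪_{X,x}/I_x` (tree
`Ideal.IsNormallyFlat`, `NormalFlatness.lean`) and permissibility by «regular + normally flat + no component»
(tree `Ideal.IsPermissible`). Reading these conditions on the local scheme `Spec 𝒪_{X,x}` (CJS p. 107: «the
claims … depend only on the localization `X_x = Spec(𝒪_{X,x})`»; Lemma 2.37 (1)) or after any base change that
does not change the local rings requires the two transport facts PROVED here:

* `Ideal.IsNormallyFlat.map_of_isLocalization` — **normal flatness localizes**: for a localization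
  `A → A' = S⁻¹A`, if `I` is normally flat then so is `IA'` — the graded pieces of `IA'` are the localizations
  `S⁻¹(I^t/I^{t+1})` (tree `exists_isLocalizedModule_gradedPiece`), i.e. base changes of the flat
  `A/I`-modules `I^t/I^{t+1}` to the localization `A'/IA'` of `A/I` (Mathlib `Module.Flat.of_isLocalizedModule`);
* `Ideal.IsNormallyFlat.map_ringEquiv`, `Ideal.isNormallyFlat_map_ringEquiv_iff` — invariance under ring
  isomorphisms (an isomorphism is a localization at `{1}`);
* `Ideal.IsPermissible.map_ringEquiv`, `Ideal.isPermissible_map_ringEquiv_iff` — the same for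
  permissibility (regularity of the quotient: Mathlib `IsRegularLocalRing.of_ringEquiv`; minimal primes
  correspond under isomorphisms).

No definitions and no named facts are introduced.

## Sources

* V. Cossart, U. Jannsen, S. Saito, *Desingularization: Invariants and Strategy*, LNM 2270 (2020), Def. 3.1,
  Thm. 3.2, p. 107, Lemma 2.37 (1). [CossartJannsenSaito2020]
* Folklore (flatness is preserved by base change; localization is exact).
-/

noncomputable section

open IsLocalRing

namespace Literature.RingTheory.HilbertSamuel

universe u v

variable {A : Type u} [CommRing A]

/-! ## Normal flatness localizes -/

/-- **Normal flatness is stable under localization** (CJS Def. 3.1; the mechanism of Thm. 3.2): if `I ⊆ A` is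
normally flat and `A' = S⁻¹A`, then `IA'` is normally flat in `A'` — `(IA')^t/(IA')^{t+1} = S⁻¹(I^t/I^{t+1})` is
the base change of the flat `A/I`-module `I^t/I^{t+1}` to the localization `A'/IA'` of `A/I`.
[cite: CossartJannsenSaito2020, Def. 3.1, Thm. 3.2 (1)] -/
theorem _root_.Ideal.IsNormallyFlat.map_of_isLocalization (S : Submonoid A) (A' : Type v) [CommRing A']
    [Algebra A A'] [IsLocalization S A'] {I : Ideal A} (h : I.IsNormallyFlat) :
    (I.map (algebraMap A A')).IsNormallyFlat := by
  intro n
  set I' : Ideal A' := I.map (algebraMap A A') with hI'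
  haveI : Module.Flat (A ⧸ I) (gradedPiece I n) := h n
  -- `(IA')ⁿ/(IA')ⁿ⁺¹` as a module over `A/I` (through `A/I → A'/IA'`)
  letI instMod : Module (A ⧸ I) (gradedPiece I' n) :=
    Module.compHom (gradedPiece I' n) (algebraMap (A ⧸ I) (A' ⧸ I'))
  haveI : IsScalarTower (A ⧸ I) (A' ⧸ I') (gradedPiece I' n) :=
    IsScalarTower.of_algebraMap_smul fun _ _ => rfl
  haveI hAAb : IsScalarTower A (A ⧸ I) (gradedPiece I' n) := by
    refine IsScalarTower.of_algebraMap_smul fun a y => ?_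
    change (Ideal.Quotient.mk I' (algebraMap A A' a)) • y = a • y
    rw [show (Ideal.Quotient.mk I' (algebraMap A A' a)) • y = (algebraMap A A' a) • y from rfl,
      algebraMap_smul]
  -- `θ : Iⁿ/Iⁿ⁺¹ → (IA')ⁿ/(IA')ⁿ⁺¹` is a localization at `S`; its `A/I`-linear version `θ'` one at `S̄ ⊆ A/I`
  obtain ⟨θ, hθloc, -⟩ := exists_isLocalizedModule_gradedPiece S A' I n
  let θ' : gradedPiece I n →ₗ[A ⧸ I] gradedPiece I' n :=
    θ.extendScalarsOfSurjective Ideal.Quotient.mk_surjective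
  have hθ' : ∀ z, θ' z = θ z := fun z => rfl
  have hmem : ∀ {t : A}, t ∈ S → Ideal.Quotient.mk I t ∈ Algebra.algebraMapSubmonoid (A ⧸ I) S :=
    fun {t} ht => ⟨t, ht, rfl⟩
  haveI hθ'loc : IsLocalizedModule (Algebra.algebraMapSubmonoid (A ⧸ I) S) θ' := by
    refine ⟨?_, ?_, ?_⟩
    · rintro ⟨sb, t, ht, rfl⟩
      have hu := hθloc.map_units ⟨t, ht⟩
      rw [Module.End.isUnit_iff] at hu ⊢
      have heq : ∀ y : gradedPiece I' n,
          (algebraMap (A ⧸ I) (Module.End (A ⧸ I) (gradedPiece I' n)) (algebraMap A (A ⧸ I) t)) y =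
            (algebraMap A (Module.End A (gradedPiece I' n)) t) y := by
        intro y
        simp only [Module.algebraMap_end_apply]
        rw [algebraMap_smul]
      constructor
      · intro y y' hyy
        rw [heq, heq] at hyy
        exact hu.1 hyy
      · intro y
        obtain ⟨y', hy'⟩ := hu.2 y
        exact ⟨y', by rw [heq, hy']⟩
    · intro y
      obtain ⟨⟨m, t⟩, hmt⟩ := hθloc.surj y
      refine ⟨(m, ⟨Ideal.Quotient.mk I t, hmem t.2⟩), ?_⟩
      change (Ideal.Quotient.mk I (t : A)) • y = θ' m
      rw [hθ', ← hmt, ← Ideal.Quotient.algebraMap_eq, algebraMap_smul]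
      rfl
    · intro x₁ x₂ hx
      rw [hθ', hθ'] at hx
      obtain ⟨c, hc⟩ := hθloc.exists_of_eq hx
      refine ⟨⟨Ideal.Quotient.mk I c, hmem c.2⟩, ?_⟩
      change (Ideal.Quotient.mk I (c : A)) • x₁ = (Ideal.Quotient.mk I (c : A)) • x₂
      rw [← Ideal.Quotient.algebraMap_eq, algebraMap_smul, algebraMap_smul]
      exact hc
  -- flatness over `A'/IA'` by base change along the localization `A/I → A'/IA'`
  exact Module.Flat.of_isLocalizedModule (A' ⧸ I') (Algebra.algebraMapSubmonoid (A ⧸ I) S) θ'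

/-! ## Invariance under ring isomorphisms -/

section RingEquiv

variable {B : Type v} [CommRing B]

/-- A ring isomorphism `e : A ≃+* B` presents `B` as the localization of `A` at the trivial submonoid (for the
algebra structure `e`); private plumbing for the transport lemmas below. [folklore] -/
private theorem isLocalization_bot_of_ringEquiv (e : A ≃+* B) :
    letI : Algebra A B := (e : A →+* B).toAlgebra
    IsLocalization (⊥ : Submonoid A) B := by
  letI : Algebra A B := (e : A →+* B).toAlgebra
  refine IsLocalization.of_le_isUnit_of_bijective ?_ e.bijective
  rintro _ ⟨a, ha, rfl⟩
  have ha1 : a = 1 := Submonoid.mem_bot.mp ha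
  subst ha1
  rw [map_one]
  exact isUnit_one

/-- **Normal flatness is invariant under ring isomorphisms**: `e(I) ⊆ B` is normally flat if `I ⊆ A` is.
[cite: CossartJannsenSaito2020, Def. 3.1 (1)] -/
theorem _root_.Ideal.IsNormallyFlat.map_ringEquiv (e : A ≃+* B) {I : Ideal A} (h : I.IsNormallyFlat) :
    (I.map (e : A →+* B)).IsNormallyFlat := by
  letI : Algebra A B := (e : A →+* B).toAlgebra
  haveI : IsLocalization (⊥ : Submonoid A) B := isLocalization_bot_of_ringEquiv e
  exact h.map_of_isLocalization ⊥ B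

/-- `e(I)` is normally flat iff `I` is. [cite: CossartJannsenSaito2020, Def. 3.1 (1)] -/
theorem _root_.Ideal.isNormallyFlat_map_ringEquiv_iff (e : A ≃+* B) (I : Ideal A) :
    (I.map (e : A →+* B)).IsNormallyFlat ↔ I.IsNormallyFlat := by
  refine ⟨fun h => ?_, fun h => h.map_ringEquiv e⟩
  have h' := h.map_ringEquiv e.symm
  rwa [Ideal.map_of_equiv] at h'

/-- Minimal primes pull back to minimal primes along a ring isomorphism (the tree's
`Resolution.comap_mem_minimalPrimes_of_ringEquiv`, restated privately so that this ring-theory file does not import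
`Literature.AlgebraicGeometry.Resolution.FormalEquidimensionality`). [folklore] -/
private theorem comap_mem_minimalPrimes_of_ringEquiv' (e : A ≃+* B) {P : Ideal B} (hP : P ∈ minimalPrimes B) :
    P.comap (e : A →+* B) ∈ minimalPrimes A := by
  have h := Ideal.minimalPrimes_comap_of_surjective (f := (e : A →+* B)) e.surjective (I := (⊥ : Ideal B)) hP
  have hbot : (⊥ : Ideal B).comap (e : A →+* B) = ⊥ := by
    rw [← RingHom.ker_eq_comap_bot]
    exact (RingHom.injective_iff_ker_eq_bot _).mp e.injective
  rwa [hbot] at h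

/-- **Permissibility is invariant under ring isomorphisms** (CJS Def. 3.1 (2): regular quotient — Mathlib
`IsRegularLocalRing.of_ringEquiv` on `A/I ≃ B/e(I)`; normal flatness — `Ideal.IsNormallyFlat.map_ringEquiv`; «in no
minimal prime» — minimal primes correspond). [cite: CossartJannsenSaito2020, Def. 3.1 (2)] -/
theorem _root_.Ideal.IsPermissible.map_ringEquiv (e : A ≃+* B) {I : Ideal A} (h : I.IsPermissible) :
    (I.map (e : A →+* B)).IsPermissible := by
  refine ⟨?_, h.isNormallyFlat.map_ringEquiv e, fun P hP hle => ?_⟩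
  · haveI := h.isRegularLocalRing
    exact IsRegularLocalRing.of_ringEquiv (Ideal.quotientEquiv I (I.map (e : A →+* B)) e rfl)
  · exact h.not_le_of_mem_minimalPrimes (comap_mem_minimalPrimes_of_ringEquiv' e hP)
      (Ideal.map_le_iff_le_comap.mp hle)

/-- `e(I)` is permissible iff `I` is. [cite: CossartJannsenSaito2020, Def. 3.1 (2)] -/
theorem _root_.Ideal.isPermissible_map_ringEquiv_iff (e : A ≃+* B) (I : Ideal A) :
    (I.map (e : A →+* B)).IsPermissible ↔ I.IsPermissible := by
  refine ⟨fun h => ?_, fun h => h.map_ringEquiv e⟩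
  have h' := h.map_ringEquiv e.symm
  rwa [Ideal.map_of_equiv] at h'

end RingEquiv

end Literature.RingTheory.HilbertSamuel

end
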